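import Mathlib
import Summits.NavierStokesRegularity.NavierStokesRegularity.Theorems.TaoLadderRungTwoFlatCoreContract
import HarnessLib

/-!
# CORE CONTRACT 64, part 1/2 (the split core clause, the weak schedule, slot monotonicity) — reference FAMILY `W z` (TRAP #25 cure α) and the SPLIT core clause (TRAP #24 cure P-64a) BY RE-INSTANCING
  (theory-1 g49 CoreContractZ64.lean 2ad286597d671f9f split at landing into two modules ≤ 400 lines: this part and `…CoreContractZLanding`)
  (theory-1 g49 numT64 design P-64b for the K_A♭ parent item stmt-NavierStokesRegularity-22987, child 2A `GradedAdiabaticWakeA`,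
  route TaoLadderRungTwoFlat; cell harvest/h2-tao-ladder, LADDER §64.2 (TRAP #24), §64.8–64.10 (TRAP #25), referee W-28)

TWO CHANGES to `…CoreContract` (p713595, of record), both append-only (new declarations; nothing landed is edited):

(α) The comparison flow is a FAMILY `W : (Fin 2 → ℤ → ℝ) → Fin 2 → ℤ → ℝ → ℝ` indexed by the hop's start state `z` (intended
    `W z = x_z • U (x_z • ·)`, `x_z = anchorScale P i₀ z`, the co-scaled pulse flow of `ScaleCovariance64`): `CoreLandingFromZ`,
    `CoreLandingWindowZ` read `W z` inside the `∀ z S₀ τ S F` binders (p1 g24 INTERIM 2 adopted the same shape for the near/behind step).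

(P-64a) NO FRAME FORK. The landed frame `InTubeWith P Bcl` hard-wires the UNIFORM core clause `CoreClause P i₀ u⋆ n z` (radius `P.δ n` on
    every `k ≥ −K`), infeasible at the wake shell `k = −K` (TRAP #24: the wake deviation is the interface level `≈ RBAR ≫ ω_{−K}·δ`).  Instead of
    forking the frame, RE-INSTANCE it: run the induction with the WEAK schedule `wakeSchedule P aK := {P with δ := aK}` (uniform radius = the
    certified wake level `aK n = AKD(n)`, true on every intended state) and carry the SHARP rows `k ≥ 1−K` (radius `δs n = δ(n)`) in the
    parametric slot: `splitBcl P Bcl δs i₀ u⋆ n z := Bcl n z ∧ CoreClauseFrom P δs i₀ u⋆ n z`.  Then `InTubeWith (wakeSchedule P aK)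
    (splitBcl …)` IS the split tube, every landed generic theorem over `InTubeWith P Bcl` (frame, choice-rule adapters, composition to gap
    data) applies verbatim, the two places where p1's near/behind chain reads the core clause at `k = −K` now read `aK` (= their AKD dictionary
    entries), and the ONE place that needs a sharp row (`interfaceStart_le_of_clauses`, row `1−K`) reads it from `(splitBcl …).2`.
    Per hop, the core obligations become: the SHARP landing `CoreClauseFrom P δs (n+1) (recentre …)` at good times (this file:
    `coreClauseFrom_landing_of_contract`, schedule row `B ≤ AFL·δs(n+1)`) — conjoined by p1 with the behind landing into `splitBcl (n+1)` via the
    generic `tubeStepBehindWith_of_good` — and the WEAK uniform landing `TubeStepCoreWith (wakeSchedule P aK) …` from the sharp rows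
    (`δs ≤ aK`) plus the WAKE ROW at `k = −K` (`wakeRow_of_levels`: interface level at time `t` + the reference's own wake residual `RW`,
    schedule row `ω_{−K}·(lev i + RW) ≤ AFL·aK(n+1)`), assembled by `tubeStepCoreWith_of_split`.

Everything below is generic in `P` and `Bcl`; `wakeSchedule` / `splitBcl` are the intended instance (rfl lemmas).
HONEST FRAMING: pure logic/bookkeeping over the cell's typed frame (MODEL lattice); the landing contract, the interface levels, the
reference wake residual and every scalar schedule row are HYPOTHESES; nothing certified; no item closed; nothing about the Navier–Stokes
equations.  Cell file (theory desk); p1 may land it or re-cut it.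
-/

noncomputable section

-- the sub-problem namespace repeats the summit name by design (D-0017)
set_option linter.dupNamespace false

namespace Summit.NavierStokesRegularity.NavierStokesRegularity.Theorems.HopTube

open Set Finset Literature.Analysis.FluidPDE Literature.Analysis.FluidPDE.TaoCascade MirrorPulse

/-! ## The split core clause and the re-instanced schedule -/

/-- **SHARP core rows from the interface shell up**: `ω_k·|z_k − x_z·u⋆_k| ≤ δs n` for `k ≥ 1−K` (the uniform `CoreClause` minus its
wake row `k = −K`). [cite: Tao2016AveragedNS, §6.3–6.4 (statement shape); cell LADDER §50 (core clause), §64.2 (TRAP #24, P-64a)] -/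
def CoreClauseFrom (P : TubeSchedule) (δs : ℕ → ℝ) (i₀ : Fin 2) (ustar : Fin 2 → ℤ → ℝ) (n : ℕ) (z : Fin 2 → ℤ → ℝ) : Prop :=
  ∀ (i : Fin 2) (k : ℤ), 1 - (P.K : ℤ) ≤ k →
    geomGauge P.g P.b i k * |z i k - anchorScale P i₀ z * ustar i k| ≤ δs n

/-- **The weak schedule**: `P` with the uniform core radius replaced by the wake level `aK` (every other field unchanged).
[cite: Tao2016AveragedNS, §6.4 (statement shape); cell LADDER §64.2 (P-64a: own field `aK = AKD`)] -/
def wakeSchedule (P : TubeSchedule) (aK : ℕ → ℝ) : TubeSchedule :=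
  { P with δ := aK }

/-- Field transport `δ` of the weak schedule. [folklore (definitional)] -/
@[simp] theorem wakeSchedule_δ (P : TubeSchedule) (aK : ℕ → ℝ) : (wakeSchedule P aK).δ = aK := rfl
/-- Field transport `K` of the weak schedule. [folklore (definitional)] -/
@[simp] theorem wakeSchedule_K (P : TubeSchedule) (aK : ℕ → ℝ) : (wakeSchedule P aK).K = P.K := rfl
/-- Field transport `N₀` of the weak schedule. [folklore (definitional)] -/
@[simp] theorem wakeSchedule_N₀ (P : TubeSchedule) (aK : ℕ → ℝ) : (wakeSchedule P aK).N₀ = P.N₀ := rfl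
/-- Field transport `D` of the weak schedule. [folklore (definitional)] -/
@[simp] theorem wakeSchedule_D (P : TubeSchedule) (aK : ℕ → ℝ) : (wakeSchedule P aK).D = P.D := rfl
/-- Field transport `k₁` of the weak schedule. [folklore (definitional)] -/
@[simp] theorem wakeSchedule_k₁ (P : TubeSchedule) (aK : ℕ → ℝ) : (wakeSchedule P aK).k₁ = P.k₁ := rfl
/-- Field transport `K₂` of the weak schedule. [folklore (definitional)] -/
@[simp] theorem wakeSchedule_K₂ (P : TubeSchedule) (aK : ℕ → ℝ) : (wakeSchedule P aK).K₂ = P.K₂ := rfl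
/-- Field transport `g` of the weak schedule. [folklore (definitional)] -/
@[simp] theorem wakeSchedule_g (P : TubeSchedule) (aK : ℕ → ℝ) : (wakeSchedule P aK).g = P.g := rfl
/-- Field transport `b` of the weak schedule. [folklore (definitional)] -/
@[simp] theorem wakeSchedule_b (P : TubeSchedule) (aK : ℕ → ℝ) : (wakeSchedule P aK).b = P.b := rfl
/-- Field transport `Astar` of the weak schedule. [folklore (definitional)] -/
@[simp] theorem wakeSchedule_Astar (P : TubeSchedule) (aK : ℕ → ℝ) : (wakeSchedule P aK).Astar = P.Astar := rfl
/-- Field transport `γ` of the weak schedule. [folklore (definitional)] -/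
@[simp] theorem wakeSchedule_γ (P : TubeSchedule) (aK : ℕ → ℝ) : (wakeSchedule P aK).γ = P.γ := rfl
/-- Field transport `θb` of the weak schedule. [folklore (definitional)] -/
@[simp] theorem wakeSchedule_θb (P : TubeSchedule) (aK : ℕ → ℝ) : (wakeSchedule P aK).θb = P.θb := rfl
/-- Field transport `θV` of the weak schedule. [folklore (definitional)] -/
@[simp] theorem wakeSchedule_θV (P : TubeSchedule) (aK : ℕ → ℝ) : (wakeSchedule P aK).θV = P.θV := rfl
/-- Field transport `v` of the weak schedule. [folklore (definitional)] -/
@[simp] theorem wakeSchedule_v (P : TubeSchedule) (aK : ℕ → ℝ) : (wakeSchedule P aK).v = P.v := rfl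
/-- Field transport `A` of the weak schedule. [folklore (definitional)] -/
@[simp] theorem wakeSchedule_A (P : TubeSchedule) (aK : ℕ → ℝ) : (wakeSchedule P aK).A = P.A := rfl
/-- Field transport `η` of the weak schedule. [folklore (definitional)] -/
@[simp] theorem wakeSchedule_η (P : TubeSchedule) (aK : ℕ → ℝ) : (wakeSchedule P aK).η = P.η := rfl

/-- The anchor scale does not see the core radius. [folklore (definitional)] -/
@[simp] theorem anchorScale_wakeSchedule (P : TubeSchedule) (aK : ℕ → ℝ) (i₀ : Fin 2) (z : Fin 2 → ℤ → ℝ) :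
    anchorScale (wakeSchedule P aK) i₀ z = anchorScale P i₀ z := rfl

/-- None of the other clauses, the anchored deviation, the clamped ratio, the choice rule or the R54 slot reads the core radius:
the weak schedule changes the uniform core clause ONLY (transport lemmas for the port, all `rfl`). [folklore (definitional)] -/
@[simp] theorem anchorClause_wakeSchedule (P : TubeSchedule) (aK : ℕ → ℝ) (i₀ : Fin 2) :
    AnchorClause (wakeSchedule P aK) i₀ = AnchorClause P i₀ := rfl
/-- Transport lemma `nearClause_wakeSchedule`: the weak schedule changes the uniform core clause only. [folklore (definitional)] -/
@[simp] theorem nearClause_wakeSchedule (P : TubeSchedule) (aK : ℕ → ℝ) (i₀ : Fin 2) (ustar : Fin 2 → ℤ → ℝ) :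
    NearClause (wakeSchedule P aK) i₀ ustar = NearClause P i₀ ustar := rfl
/-- Transport lemma `aheadClause_wakeSchedule`: the weak schedule changes the uniform core clause only. [folklore (definitional)] -/
@[simp] theorem aheadClause_wakeSchedule (P : TubeSchedule) (aK : ℕ → ℝ) (w : ℤ → ℝ) (r : ℝ) :
    AheadClause (wakeSchedule P aK) w r = AheadClause P w r := rfl
/-- Transport lemma `captureClause_wakeSchedule`: the weak schedule changes the uniform core clause only. [folklore (definitional)] -/
@[simp] theorem captureClause_wakeSchedule (P : TubeSchedule) (aK : ℕ → ℝ) (ζ : ℕ → Fin 2 → ℤ → ℝ) :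
    CaptureClause (wakeSchedule P aK) ζ = CaptureClause P ζ := rfl
/-- Transport lemma `behindClause_wakeSchedule`: the weak schedule changes the uniform core clause only. [folklore (definitional)] -/
@[simp] theorem behindClause_wakeSchedule (P : TubeSchedule) (aK : ℕ → ℝ) (ε₀ : ℝ) :
    BehindClause (wakeSchedule P aK) ε₀ = BehindClause P ε₀ := rfl
/-- Transport lemma `behindR54_wakeSchedule`: the weak schedule changes the uniform core clause only. [folklore (definitional)] -/
@[simp] theorem behindR54_wakeSchedule (P : TubeSchedule) (aK : ℕ → ℝ) (θ' : ℝ) (Wb : ℕ → ℝ) :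
    behindR54 (wakeSchedule P aK) θ' Wb = behindR54 P θ' Wb := rfl
/-- Transport lemma `anchoredDev_wakeSchedule`: the weak schedule changes the uniform core clause only. [folklore (definitional)] -/
@[simp] theorem anchoredDev_wakeSchedule (P : TubeSchedule) (aK : ℕ → ℝ) (i₀ : Fin 2) (ustar : Fin 2 → ℤ → ℝ) :
    anchoredDev (wakeSchedule P aK) i₀ ustar = anchoredDev P i₀ ustar := rfl
/-- Transport lemma `clampedRatio_wakeSchedule`: the weak schedule changes the uniform core clause only. [folklore (definitional)] -/
@[simp] theorem clampedRatio_wakeSchedule (P : TubeSchedule) (aK : ℕ → ℝ) (i₀ : Fin 2) (ε₀ θ₀ : ℝ) :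
    clampedRatio (wakeSchedule P aK) i₀ ε₀ θ₀ = clampedRatio P i₀ ε₀ θ₀ := rfl
/-- Transport lemma `choiceRule_wakeSchedule`: the weak schedule changes the uniform core clause only. [folklore (definitional)] -/
@[simp] theorem choiceRule_wakeSchedule (P : TubeSchedule) (aK : ℕ → ℝ) (i₀ : Fin 2) (ε₀ θ₀ t₀ : ℝ)
    (good : ℕ → (Fin 2 → ℤ → ℝ → ℝ) → ℝ → Prop) :
    choiceRule (wakeSchedule P aK) i₀ ε₀ θ₀ t₀ good = choiceRule P i₀ ε₀ θ₀ t₀ good := rfl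

/-- The sharp rows do not see the core radius field either. [folklore (definitional)] -/
@[simp] theorem coreClauseFrom_wakeSchedule (P : TubeSchedule) (aK δs : ℕ → ℝ) (i₀ : Fin 2) (ustar : Fin 2 → ℤ → ℝ)
    (n : ℕ) (z : Fin 2 → ℤ → ℝ) :
    CoreClauseFrom (wakeSchedule P aK) δs i₀ ustar n z ↔ CoreClauseFrom P δs i₀ ustar n z := Iff.rfl

/-- The uniform clause of the weak schedule is the uniform clause with radius `aK n`. [folklore (definitional)] -/
theorem coreClause_wakeSchedule_iff (P : TubeSchedule) (aK : ℕ → ℝ) (i₀ : Fin 2) (ustar : Fin 2 → ℤ → ℝ) (n : ℕ)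
    (z : Fin 2 → ℤ → ℝ) :
    CoreClause (wakeSchedule P aK) i₀ ustar n z ↔
      ∀ (i : Fin 2) (k : ℤ), -(P.K : ℤ) ≤ k → geomGauge P.g P.b i k * |z i k - anchorScale P i₀ z * ustar i k| ≤ aK n :=
  Iff.rfl

/-- **The split instance of the parametric slot**: behind clause AND sharp core rows.
[cite: Tao2016AveragedNS, §6.3–6.4 (statement shape); cell LADDER §57.5 (parametric slot), §64.2 (P-64a)] -/
def splitBcl (P : TubeSchedule) (Bcl : ℕ → (Fin 2 → ℤ → ℝ) → Prop) (δs : ℕ → ℝ) (i₀ : Fin 2) (ustar : Fin 2 → ℤ → ℝ) :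
    ℕ → (Fin 2 → ℤ → ℝ) → Prop :=
  fun n z => Bcl n z ∧ CoreClauseFrom P δs i₀ ustar n z

/-- **Sharp rows + wake row ⇒ the uniform clause** (for any schedule whose radius dominates the sharp one).
[cite: Tao2016AveragedNS, §6.3–6.4 (statement shape); cell LADDER §64.2 (TRAP #24)] -/
theorem coreClause_of_from_of_row (P : TubeSchedule) {δs : ℕ → ℝ} {i₀ : Fin 2} {ustar : Fin 2 → ℤ → ℝ} {n : ℕ}
    {z : Fin 2 → ℤ → ℝ} (hfrom : CoreClauseFrom P δs i₀ ustar n z)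
    (hrow : ∀ i : Fin 2, geomGauge P.g P.b i (-(P.K : ℤ)) *
      |z i (-(P.K : ℤ)) - anchorScale P i₀ z * ustar i (-(P.K : ℤ))| ≤ P.δ n)
    (hle : δs n ≤ P.δ n) : CoreClause P i₀ ustar n z := by
  intro i k hk
  rcases eq_or_lt_of_le hk with h | h
  · rw [← h]; exact hrow i
  · exact (hfrom i k (by omega)).trans hle

/-- Conversely a uniform-clause state has the sharp rows with the same radius (the old tube is the instance `δs = aK = P.δ`).
[folklore (definitional); cell LADDER §64.2] -/
theorem coreClauseFrom_of_coreClause (P : TubeSchedule) {i₀ : Fin 2} {ustar : Fin 2 → ℤ → ℝ} {n : ℕ} {z : Fin 2 → ℤ → ℝ}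
    (h : CoreClause P i₀ ustar n z) : CoreClauseFrom P P.δ i₀ ustar n z :=
  fun i k hk => h i k (by omega)

/-- **The re-instanced tube, unfolded from the entry hop on**: anchor ∧ uniform core (radius `aK n`) ∧ near ∧ (behind ∧ sharp rows) ∧ ahead.
[folklore (definitional); cell LADDER §57.5, §64.2 (P-64a by re-instancing)] -/
theorem inTubeWith_split_iff_of_lt (P : TubeSchedule) (aK δs : ℕ → ℝ) (Bcl : ℕ → (Fin 2 → ℤ → ℝ) → Prop) (i₀ : Fin 2)
    (X₀ : Fin 2 → ℝ) (w : ℤ → ℝ) (r : ℝ) (ζ : ℕ → Fin 2 → ℤ → ℝ) (ustar : Fin 2 → ℤ → ℝ) {n : ℕ} (z : Fin 2 → ℤ → ℝ)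
    (hn : P.N₀ < n) :
    InTubeWith (wakeSchedule P aK) (splitBcl P Bcl δs i₀ ustar) i₀ X₀ w r ζ ustar n z ↔
      AnchorClause P i₀ n z ∧ CoreClause (wakeSchedule P aK) i₀ ustar n z ∧ NearClause P i₀ ustar n z ∧
        (Bcl n z ∧ CoreClauseFrom P δs i₀ ustar n z) ∧ AheadClause P w r z := by
  have h0 : n ≠ 0 := by omega
  have h1 : ¬ n ≤ (wakeSchedule P aK).N₀ := by rw [wakeSchedule_N₀]; omega
  unfold InTubeWith
  rw [if_neg h0, if_neg h1]
  exact Iff.rfl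

/-! ## Slot monotonicity (the split slot is STRONGER than the behind slot alone: obligations with slot-free conclusions transfer) -/

section SlotMono

variable {P : TubeSchedule} {Bcl Bcl' : ℕ → (Fin 2 → ℤ → ℝ) → Prop} {i₀ : Fin 2} {X₀ : Fin 2 → ℝ} {w : ℤ → ℝ} {r : ℝ}
  {ζ : ℕ → Fin 2 → ℤ → ℝ} {ustar : Fin 2 → ℤ → ℝ}

/-- `H(n)` is monotone in the slot. [folklore (definitional); cell LADDER §57.5] -/
theorem inTubeWith_mono_slot (h : ∀ n z, Bcl' n z → Bcl n z) {n : ℕ} {z : Fin 2 → ℤ → ℝ}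
    (hz : InTubeWith P Bcl' i₀ X₀ w r ζ ustar n z) : InTubeWith P Bcl i₀ X₀ w r ζ ustar n z := by
  by_cases h0 : n = 0
  · simp only [InTubeWith, if_pos h0] at hz ⊢
    exact hz
  · by_cases h1 : n ≤ P.N₀
    · simp only [InTubeWith, if_neg h0, if_pos h1] at hz ⊢
      exact hz
    · simp only [InTubeWith, if_neg h0, if_neg h1] at hz ⊢
      exact ⟨hz.1, hz.2.1, hz.2.2.1, h n z hz.2.2.2.1, hz.2.2.2.2⟩

/-- The split slot implies the behind slot. [folklore (definitional)] -/
theorem splitBcl_fst (P : TubeSchedule) (Bcl : ℕ → (Fin 2 → ℤ → ℝ) → Prop) (δs : ℕ → ℝ) (i₀ : Fin 2)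
    (ustar : Fin 2 → ℤ → ℝ) : ∀ n z, splitBcl P Bcl δs i₀ ustar n z → Bcl n z :=
  fun _ _ h => h.1

variable {𝕊 : Finset (ℤ × ℤ × ℤ)} {σ ε₀ : ℝ} {α : Fin 2 → Fin 2 → Fin 2 → ℤ × ℤ × ℤ → ℝ} {θ₀ c₀ : ℝ} {env₀ : ℤ → ℝ}
  {rule : HopRule} {n : ℕ}

/-- The hop premise is monotone in the slot. [folklore (definitional); cell LADDER §57.5] -/
theorem hopPremiseWith_mono_slot (h : ∀ n z, Bcl' n z → Bcl n z) {z S₀ : Fin 2 → ℤ → ℝ} {τ : ℝ}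
    {S F : Fin 2 → ℤ → ℝ → ℝ} (hp : HopPremiseWith P Bcl' 𝕊 ε₀ i₀ α X₀ w r c₀ ζ ustar n z S₀ τ S F) :
    HopPremiseWith P Bcl 𝕊 ε₀ i₀ α X₀ w r c₀ ζ ustar n z S₀ τ S F :=
  ⟨inTubeWith_mono_slot h hp.1, hp.2⟩

/-- Obligations with slot-free conclusions pass to a STRONGER slot (near). [folklore (definitional); cell LADDER §57.5, §64.2] -/
theorem tubeStepNearWith_mono_slot (h : ∀ n z, Bcl' n z → Bcl n z)
    (H : TubeStepNearWith P Bcl rule 𝕊 ε₀ i₀ α X₀ w r c₀ ζ ustar n) :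
    TubeStepNearWith P Bcl' rule 𝕊 ε₀ i₀ α X₀ w r c₀ ζ ustar n :=
  fun z S₀ τ S F hp => H z S₀ τ S F (hopPremiseWith_mono_slot h hp)

/-- (anchor) [folklore (definitional)] -/
theorem tubeStepAnchorWith_mono_slot (h : ∀ n z, Bcl' n z → Bcl n z)
    (H : TubeStepAnchorWith P Bcl rule 𝕊 ε₀ i₀ α X₀ w r c₀ ζ ustar n) :
    TubeStepAnchorWith P Bcl' rule 𝕊 ε₀ i₀ α X₀ w r c₀ ζ ustar n :=
  fun z S₀ τ S F hp => H z S₀ τ S F (hopPremiseWith_mono_slot h hp)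

/-- (ahead) [folklore (definitional)] -/
theorem tubeStepAheadWith_mono_slot (h : ∀ n z, Bcl' n z → Bcl n z)
    (H : TubeStepAheadWith P Bcl rule 𝕊 ε₀ i₀ α X₀ w r c₀ ζ ustar n) :
    TubeStepAheadWith P Bcl' rule 𝕊 ε₀ i₀ α X₀ w r c₀ ζ ustar n :=
  fun z S₀ τ S F hp => H z S₀ τ S F (hopPremiseWith_mono_slot h hp)

/-- (core, uniform clause) [folklore (definitional)] -/
theorem tubeStepCoreWith_mono_slot (h : ∀ n z, Bcl' n z → Bcl n z)
    (H : TubeStepCoreWith P Bcl rule 𝕊 ε₀ i₀ α X₀ w r c₀ ζ ustar n) :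
    TubeStepCoreWith P Bcl' rule 𝕊 ε₀ i₀ α X₀ w r c₀ ζ ustar n :=
  fun z S₀ τ S F hp => H z S₀ τ S F (hopPremiseWith_mono_slot h hp)

/-- (clock) [folklore (definitional)] -/
theorem tubeStepClockWith_mono_slot (h : ∀ n z, Bcl' n z → Bcl n z)
    (H : TubeStepClockWith P Bcl rule 𝕊 σ ε₀ i₀ α X₀ w r θ₀ c₀ ζ ustar n) :
    TubeStepClockWith P Bcl' rule 𝕊 σ ε₀ i₀ α X₀ w r θ₀ c₀ ζ ustar n :=
  fun z S₀ τ S F hp => H z S₀ τ S F (hopPremiseWith_mono_slot h hp)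

/-- (envelope) [folklore (definitional)] -/
theorem tubeStepEnvelopeWith_mono_slot (h : ∀ n z, Bcl' n z → Bcl n z)
    (H : TubeStepEnvelopeWith P Bcl rule 𝕊 ε₀ i₀ α X₀ w r c₀ env₀ ζ ustar n) :
    TubeStepEnvelopeWith P Bcl' rule 𝕊 ε₀ i₀ α X₀ w r c₀ env₀ ζ ustar n :=
  fun z S₀ τ S F hp => H z S₀ τ S F (hopPremiseWith_mono_slot h hp)

/-- (behind, into the split slot): the behind landing under the stronger premise AND the sharp landing give the split slot's obligation.
[folklore (definitional); cell LADDER §64.2 (P-64a)] -/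
theorem tubeStepBehindWith_split {δs : ℕ → ℝ}
    (HB : ∀ z S₀ τ S F, HopPremiseWith P (splitBcl P Bcl δs i₀ ustar) 𝕊 ε₀ i₀ α X₀ w r c₀ ζ ustar n z S₀ τ S F →
      Bcl (n + 1) (recentre S (rule.τ₁ n S) (rule.a n S)))
    (HC : ∀ z S₀ τ S F, HopPremiseWith P (splitBcl P Bcl δs i₀ ustar) 𝕊 ε₀ i₀ α X₀ w r c₀ ζ ustar n z S₀ τ S F →
      CoreClauseFrom P δs i₀ ustar (n + 1) (recentre S (rule.τ₁ n S) (rule.a n S))) :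
    TubeStepBehindWith P (splitBcl P Bcl δs i₀ ustar) rule 𝕊 ε₀ i₀ α X₀ w r c₀ ζ ustar n :=
  fun z S₀ τ S F hp => ⟨HB z S₀ τ S F hp, HC z S₀ τ S F hp⟩

end SlotMono

end Summit.NavierStokesRegularity.NavierStokesRegularity.Theorems.HopTube

end
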